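import Literature.AlgebraicGeometry.Resolution.StrictTransformTransport
import Literature.AlgebraicGeometry.Resolution.SeparatingClosures
import Literature.AlgebraicGeometry.Resolution.StrictTransformFlatteningBaseReduction
import Literature.AlgebraicGeometry.Morphisms.CompactOpenNeighbourhood
import HarnessLib

/-!
# Making the strict transform of a proper morphism an isomorphism near the closure of `T`
# (Stacks 0F3W, conditional on Raynaud–Gruson flattening)

Topic: `Literature/AlgebraicGeometry/Resolution`. The Stacks Project, Tag 0F3W (More on Flatness,
Lemma 38.33.3): "Let `f : X → Y` be a proper morphism of quasi-compact and quasi-separated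
schemes. Let `V ⊂ Y` be a quasi-compact open and `U = f⁻¹(V)`. Let `T ⊂ V` be a closed subset
such that `f|_U : U → V` is an isomorphism over an open neighbourhood of `T` in `V`. Then there
exists a `V`-admissible blowing up `Y' → Y` such that the strict transform `f' : X' → Y'` of `f`
is an isomorphism over an open neighbourhood of the closure of `T` in `Y'`." It is the step of
the two-piece induction (Tag 0F40) of the proof of Nagata's compactification theorem (Tag 0F41)
which arranges that `p₁ : X₁₂ → X₁` is an isomorphism near `Z̄₁,₂`.

PROVED, conditionally on the named fact `Stacks081R` (Raynaud–Gruson flattening, the only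
undischarged input, through Tag 081S = `stacks081S_of_stacks081R`), following the printed proof:
"Let `T' ⊂ V` be the complement of the maximal open over which `f|_U` is an isomorphism [we use
the complement of the given neighbourhood]. Then `T', T` are closed in `V` and `T ∩ T' = ∅`.
Since `V` is a spectral topological space we can find constructible closed subsets `T_c, T'_c`
with `T ⊂ T_c`, `T' ⊂ T'_c` such that `T_c ∩ T'_c = ∅` (`Morphisms.exists_isCompact_isOpen_superset`).
By Lemma 0F3V (`stacks0F3V`) we may, after replacing `Y` by a `V`-admissible blowing up, assume
that `T_c` and `T'_c` have disjoint closures in `Y`. [Let `Y₀` be a quasi-compact open containing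
`T̄_c` and missing `T̄'_c`;] `V₀ = V ∩ Y₀`, `U₀ = U ×_V V₀`, `X₀ = X ×_Y Y₀`. Since `U₀ → V₀` is
an isomorphism, we can find a `V₀`-admissible blowing up `Y₀' → Y₀` such that the strict
transform `X₀'` of `X₀` maps isomorphically to `Y₀'`, see Lemma 081S [an open immersion by 081S,
an isomorphism because it is proper with dense image]. By Divisors, Lemma 080M there exists a
`V`-admissible blow up `Y' → Y` whose restriction to `Y₀` is `Y₀' → Y₀`
(`exists_fg_comap_ι_eq_of_disjoint`). If `f' : X' → Y'` denotes the strict transform of `f`,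
then we see what we want is true because `f'` restricts to an isomorphism over `Y₀'`."

All blowing ups are kept NORMALISED (centre supported on exactly the complement of the preimage
of `V`, `StrictTransformTransport.lean`), which is what makes the strict transforms along the
tower `Y' → Y₁ → Y_V → Y` compose (`blowupStrictTransformMap_tower_iff`).

* `blowupStrictTransformMap_tower_iff` — strict transform of a strict transform along a
  normalised tower versus the strict transform along the composite;
* `stacks0F3W_of_stacks081R` — **Stacks 0F3W** (conditional on `Stacks081R`), with the
  `V`-admissible blowing up normalised (`V(𝓠) = Y ∖ V`) and the conclusion: an open `N'` of `Y'`
  containing the closure of the preimage of `T` over which the strict transform is an isomorphism.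

## References

* The Stacks Project, Tag 0F3W (Lemma 38.33.3) and its proof; Tags 0F3V, 081S, 080M, 0F40.
  [StacksProject]
-/

noncomputable section

-- Mathlib's pull-back API is stated through `abbrev`s over `limit`; as in Mathlib's own
-- algebraic-geometry files we let `simp`/unification see through them.
set_option backward.isDefEq.respectTransparency false

open CategoryTheory CategoryTheory.Limits AlgebraicGeometry TopologicalSpace
open Literature.AlgebraicGeometry.Morphisms

namespace Literature.AlgebraicGeometry.Resolution

universe u

/-! ## Strict transforms along a normalised tower -/

section Tower

variable {X S S₁ S₂ : Scheme.{u}} (f : X ⟶ S) {b : S₁ ⟶ S} {Q : S.IdealSheafData} (V : S.Opens)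

/-- **Strict transform of a strict transform, along a normalised tower.** Let `b : S₁ → S` be a
morphism with `V(𝓠) = S ∖ V` exactly and `b⁻¹𝓠 𝒪_{S₁}` an effective Cartier divisor (e.g. the
normalised blowing up in `𝓠`), `f₁ : X₁ → S₁` the strict transform of `f` along `b`, `β : S₂ → S₁`
any morphism, `𝓙` an ideal sheaf on `S₁` with `V(𝓙) = S₁ ∖ b⁻¹V` and `β⁻¹𝓙 𝒪_{S₂}` an effective
Cartier divisor, and `𝓠₂` an ideal sheaf on `S` with `V(𝓠₂) = S ∖ V` and `(β ≫ b)⁻¹𝓠₂` effective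
Cartier. Then for a property of morphisms respecting isomorphisms, `P` holds for the strict
transform of `f₁` along `β` (w.r.t. `V(𝓙)`) iff it holds for the strict transform of `f` along
`β ≫ b` (w.r.t. `V(𝓠₂)`): both are the closure of the part over `(β ≫ b)⁻¹V`.
[cite: StacksProject, Tag 080D] -/
theorem blowupStrictTransformMap_tower_iff (P : MorphismProperty Scheme.{u}) [P.RespectsIso]
    (hQ : (Q.support : Set S) = (V : Set S)ᶜ) (hE : IsEffectiveCartier (Q.comap b))
    (β : S₂ ⟶ S₁) (J : S₁.IdealSheafData)
    (hJ : (J.support : Set S₁) = ((b ⁻¹ᵁ V : S₁.Opens) : Set S₁)ᶜ) (hEJ : IsEffectiveCartier (J.comap β))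
    (Q₂ : S.IdealSheafData) (hQ₂ : (Q₂.support : Set S) = (V : Set S)ᶜ)
    (hE₂ : IsEffectiveCartier (Q₂.comap (β ≫ b))) :
    P (blowupStrictTransformMap (blowupStrictTransformMap f b Q) β J) ↔
      P (blowupStrictTransformMap f (β ≫ b) Q₂) := by
  have hccQ : centreCompl Q = V := centreCompl_eq_of_support_eq hQ
  have hccQ₂ : centreCompl Q₂ = V := centreCompl_eq_of_support_eq hQ₂
  have hccJ : centreCompl J = b ⁻¹ᵁ V := centreCompl_eq_of_support_eq hJ
  haveI : QuasiCompact ((pullback.snd f (β ≫ b)) ⁻¹ᵁ ((β ≫ b) ⁻¹ᵁ centreCompl Q₂)).ι := by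
    rw [preimage_centreCompl]
    exact quasiCompact_ι_preimage_centreCompl _ hE₂
  rw [blowupStrictTransformMap_comp_base_iff f b β J Q₂ P
    (by rw [hccJ, hccQ₂, Scheme.Hom.comp_preimage])]
  haveI : IsIso (blowupStrictTransformι f b Q ∣_ (pullback.snd f b) ⁻¹ᵁ centreCompl J) := by
    rw [hccJ, ← hccQ]
    exact isIso_blowupStrictTransformι_morphismRestrict f b Q hE
  exact blowupStrictTransformMap_comp_iff_of_isClosedImmersion (blowupStrictTransformι f b Q)
    (pullback.snd f b) β J P hEJ

end Tower

/-! ## Stacks 0F3W -/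

section Main

variable {X Y : Scheme.{u}} [CompactSpace Y] [QuasiSeparatedSpace Y] (f : X ⟶ Y) [IsProper f]
  (V : Y.Opens) (hV : IsCompact (V : Set Y)) (T : Set Y) (hTV : T ⊆ V)
  (hTcl : closure T ∩ (V : Set Y) ⊆ T) (N : Y.Opens) (hNV : N ≤ V) (hTN : T ⊆ N)

include hV hTV hTcl hNV hTN in
/-- **Stacks 0F3W, conditional on Raynaud–Gruson flattening (`Stacks081R`).** Let `f : X → Y` be
proper with `Y` quasi-compact and quasi-separated, `V ⊆ Y` a quasi-compact open, `T ⊆ V` closed in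
`V`, and `N ⊆ V` an open neighbourhood of `T` over which `f` is an isomorphism. Then there are a
`V`-admissible blowing up `b : Y' → Y` — the blowing up in an ideal sheaf `𝓠` of finite type with
`V(𝓠) = Y ∖ V` — and an open `N' ⊆ Y'` containing the closure of `b⁻¹(T)` over which the strict
transform `X' → Y'` of `f` (Stacks 080D, w.r.t. `V(𝓠)`) is an isomorphism.
[cite: StacksProject, Tag 0F3W] -/
theorem stacks0F3W_of_stacks081R (hRG : Stacks081R.{u}) [IsIso (f ∣_ N)] :
    ∃ (Q : Y.IdealSheafData) (Y' : Scheme.{u}) (b : Y' ⟶ Y) (N' : Y'.Opens),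
      (∀ W : Y.affineOpens, (Q.ideal W).FG) ∧ (Q.support : Set Y) = (V : Set Y)ᶜ ∧ IsBlowup b Q ∧
      closure (b ⁻¹' T) ⊆ N' ∧ IsIso (blowupStrictTransformMap f b Q ∣_ N') := by
  /- Step 0: a first normalised blowing up `bv : Yv → Y` (centre supported on exactly `Y ∖ V`) -/
  obtain ⟨Qv, Yv, bv, hQvfg, hQvsupp, hbv, hbvp⟩ := exists_isBlowup_normalised V hV
  haveI := hbvp
  haveI : CompactSpace Yv := QuasiCompact.compactSpace_of_compactSpace bv
  haveI : QuasiSeparatedSpace Yv := quasiSeparatedSpace_of_quasiSeparated bv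
  set Vv : Yv.Opens := bv ⁻¹ᵁ V with hVv
  set Nv : Yv.Opens := bv ⁻¹ᵁ N with hNv
  set Tv : Set Yv := bv ⁻¹' T with hTv
  have hVvc : IsCompact (Vv : Set Yv) := bv.isCompact_preimage hV
  have hTVv : Tv ⊆ Vv := fun x hx => hTV hx
  have hTNv : Tv ⊆ Nv := fun x hx => hTN hx
  have hNVv : Nv ≤ Vv := fun x hx => hNV hx
  have hTvcl : closure Tv ∩ (Vv : Set Yv) ⊆ Tv := by
    rintro x ⟨hx, hxV⟩
    have h1 : bv x ∈ closure T :=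
      (closure_minimal (Set.preimage_mono subset_closure) (isClosed_closure.preimage bv.continuous)) hx
    exact hTcl ⟨h1, hxV⟩
  /- Step 1: constructible closed `T₁ ⊇ Tv`, `T₂ ⊇ Vv ∖ Nv` in `Vv`, disjoint; namely
    `T₁ = Vv ∖ W`, `T₂ = Vv ∖ W'` for quasi-compact opens `W ⊇ Vv ∖ Nv` missing `Tv` and
    `W' ⊇ Vv ∖ W` inside `Nv` -/
  obtain ⟨W, hWc, hW₁, hW₂⟩ := exists_isCompact_isOpen_superset (X := Yv) (K := (Vv : Set Yv) \ Nv)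
    (O := (Vv : Set Yv) \ closure Tv) (hVvc.diff Nv.2) (Vv.2.sdiff isClosed_closure) (by
      rintro x ⟨hxV, hxN⟩
      exact ⟨hxV, fun hx => hxN (hTNv (hTvcl ⟨hx, hxV⟩))⟩)
  have hWV : (W : Set Yv) ⊆ Vv := fun x hx => (hW₂ hx).1
  have hWT : Disjoint (W : Set Yv) Tv := Set.disjoint_left.mpr fun x hx hxT => (hW₂ hx).2 (subset_closure hxT)
  obtain ⟨W', hW'c, hW'₁, hW'₂⟩ := exists_isCompact_isOpen_superset (X := Yv) (K := (Vv : Set Yv) \ W)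
    (O := (Nv : Set Yv)) (hVvc.diff W.2) Nv.2 (by
      rintro x ⟨hxV, hxW⟩
      by_contra hxN
      exact hxW (hW₁ ⟨hxV, hxN⟩))
  have hW'V : (W' : Set Yv) ⊆ Vv := fun x hx => hNVv (hW'₂ hx)
  set T₁ : Set Yv := (Vv : Set Yv) \ W with hT₁
  set T₂ : Set Yv := (Vv : Set Yv) \ W' with hT₂
  have hTvT₁ : Tv ⊆ T₁ := fun x hx => ⟨hTVv hx, fun hxW => Set.disjoint_left.mp hWT hxW hx⟩
  have hT₁₂ : Disjoint T₁ T₂ := Set.disjoint_left.mpr fun x hx₁ hx₂ => hx₂.2 (hW'₁ hx₁)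
  /- Step 2 (0F3V): a `Vv`-admissible blowing up `b₁ : Y₁ → Yv` separating the closures of
    `T₁` and `T₂`; normalise the tower -/
  obtain ⟨C₁, Y₁, b₁, hC₁fg, hC₁V, hb₁, hsep⟩ := stacks0F3V (X := Yv) Vv T₁ T₂ Set.sdiff_subset
    Set.sdiff_subset (by rw [hT₁, Set.sdiff_sdiff_cancel_left hWV]; exact W.2)
    (by rw [hT₂, Set.sdiff_sdiff_cancel_left hW'V]; exact W'.2)
    (by rw [hT₁, Set.sdiff_sdiff_cancel_left hWV]; exact hWc)
    (by rw [hT₂, Set.sdiff_sdiff_cancel_left hW'V]; exact hW'c) hT₁₂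
  obtain ⟨hb₁', hC₁'fg, hC₁'supp, Q₁, hQ₁fg, hQ₁supp, hbQ₁⟩ :=
    hbv.normalised_comp hQvfg hQvsupp hb₁ hC₁fg hC₁V
  haveI : IsProper b₁ := IsBlowup.isProper_of_fg hC₁fg hb₁
  haveI : CompactSpace Y₁ := QuasiCompact.compactSpace_of_compactSpace b₁
  haveI : QuasiSeparatedSpace Y₁ := quasiSeparatedSpace_of_quasiSeparated b₁
  set b₀₁ : Y₁ ⟶ Y := b₁ ≫ bv with hb₀₁
  have hEQ₁ : IsEffectiveCartier (Q₁.comap b₀₁) := hbQ₁.isEffectiveCartier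
  have hccQ₁ : centreCompl Q₁ = V := centreCompl_eq_of_support_eq hQ₁supp
  -- the strict transform `f₁ : X₁ → Y₁` of `f` along `b₀₁`, an isomorphism over `N₁ = b₁⁻¹W'`
  set f₁ := blowupStrictTransformMap f b₀₁ Q₁ with hf₁
  set V₁ : Y₁.Opens := b₀₁ ⁻¹ᵁ V with hV₁
  set N₁ : Y₁.Opens := b₁ ⁻¹ᵁ W' with hN₁
  have hV₁c : IsCompact (V₁ : Set Y₁) := b₀₁.isCompact_preimage hV
  have hN₁le : N₁ ≤ b₀₁ ⁻¹ᵁ N := fun x hx => hW'₂ hx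
  haveI : IsIso (f₁ ∣_ b₀₁ ⁻¹ᵁ N) :=
    isIso_blowupStrictTransformMap_morphismRestrict_of_le f b₀₁ Q₁ hEQ₁ (hccQ₁ ▸ hNV)
  haveI : IsIso (f₁ ∣_ N₁) := Morphisms.isIso_morphismRestrict_of_le f₁ hN₁le
  -- the disjoint closed sets `A ⊇ closure (b₀₁⁻¹ T)` and `B`
  set A : Set Y₁ := closure (b₁ ⁻¹' T₁) with hA
  set B : Set Y₁ := closure (b₁ ⁻¹' T₂) with hB
  /- Step 3: a quasi-compact open `Y₀ ⊇ A` missing `B`; over `V₁ ∩ Y₀ ⊆ N₁`, `f₁` is an isomorphism -/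
  obtain ⟨Y₀, hY₀c, hAY₀, hY₀B⟩ := exists_isCompact_isOpen_separating (X := Y₁) isClosed_closure
    isClosed_closure hsep
  have hVY₀ : V₁ ⊓ Y₀ ≤ N₁ := by
    rintro x ⟨hxV, hxY⟩
    have hx2 : b₁ x ∉ T₂ := fun h => Set.disjoint_left.mp hY₀B hxY (subset_closure h)
    by_contra hxN
    exact hx2 ⟨hxV, hxN⟩
  haveI : IsIso (f₁ ∣_ (V₁ ⊓ Y₀)) := Morphisms.isIso_morphismRestrict_of_le f₁ hVY₀
  /- Step 4 (081S over `Y₀`): the strict transform of `φ = f₁ ×_{Y₁} Y₀ → Y₀` along a normalised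
    `O₀`-admissible blowing up `by₀ : Y₀' → Y₀` (`O₀ = V₁ ∩ Y₀`) is an open immersion, hence an
    isomorphism (it is proper with dense image) -/
  haveI : CompactSpace (Y₀ : Scheme.{u}) := isCompact_iff_compactSpace.mp hY₀c
  haveI : QuasiSeparatedSpace (Y₀ : Scheme.{u}) := quasiSeparatedSpace_of_quasiSeparated Y₀.ι
  set φ := pullback.snd f₁ Y₀.ι with hφ
  set O₀ : (Y₀ : Scheme.{u}).Opens := Y₀.ι ⁻¹ᵁ V₁ with hO₀
  have hO₀' : Y₀.ι ⁻¹ᵁ (V₁ ⊓ Y₀) = O₀ := by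
    ext x
    exact ⟨fun h => h.1, fun h => ⟨h, x.2⟩⟩
  have hO₀c : IsCompact (O₀ : Set (Y₀ : Scheme.{u})) := by
    rw [Y₀.ι.isOpenEmbedding.isInducing.isCompact_iff]
    have e : (Y₀.ι.base) '' (O₀ : Set (Y₀ : Scheme.{u})) = (V₁ : Set Y₁) ∩ Y₀ := by
      rw [show (O₀ : Set (Y₀ : Scheme.{u})) = Y₀.ι.base ⁻¹' (V₁ : Set Y₁) from rfl,
        Set.image_preimage_eq_inter_range, Scheme.Opens.range_ι]
    rw [e]
    exact QuasiSeparatedSpace.inter_isCompact _ _ V₁.2 hV₁c Y₀.2 hY₀c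
  haveI : IsIso (φ ∣_ O₀) := by
    have h := isIso_morphismRestrict_pullback_snd f₁ Y₀.ι (V₁ ⊓ Y₀)
    rw [hO₀'] at h
    exact h
  obtain ⟨Qy, Y₀', by₀, hQyfg, hQysupp, hby₀, hopen⟩ := stacks081S_of_stacks081R hRG φ O₀ hO₀c
  have hccQy : centreCompl Qy = O₀ := centreCompl_eq_of_support_eq hQysupp
  haveI := hopen
  set ψ₀ := blowupStrictTransformMap φ by₀ Qy with hψ₀
  haveI : IsIso ψ₀ := by
    obtain ⟨hqc, hsd⟩ := hby₀.quasiCompact_and_isSchemeTheoreticallyDominant_ι_preimage hQysupp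
    haveI := hqc
    haveI := hsd
    have hD : Dense (((by₀ ⁻¹ᵁ O₀ : Y₀'.Opens)) : Set Y₀') := by
      rw [← Scheme.Opens.range_ι]
      exact (by₀ ⁻¹ᵁ O₀).ι.denseRange
    refine isIso_of_isOpenImmersion_of_universallyClosed_of_dense ψ₀ hD ?_
    intro y hy
    -- `by₀ y ∈ O₀` is hit by `φ` (an isomorphism over `O₀`), so `y` lifts to `φ ×_{Y₀} Y₀'`, in
    -- the open over `by₀⁻¹(Y₀ ∖ V(𝓠y))`, hence to the strict transform
    have hy' : by₀ y ∈ Set.range φ := by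
      obtain ⟨x, hx⟩ := (ConcreteCategory.bijective_of_isIso (φ ∣_ O₀).base).2 ⟨by₀ y, hy⟩
      exact ⟨x.1, by rw [← morphismRestrict_base_coe φ O₀ x, hx]⟩
    obtain ⟨z, hz⟩ : y ∈ Set.range (pullback.snd φ by₀) := by rw [Scheme.Pullback.range_snd]; exact hy'
    have hzO : z ∈ ((pullback.snd φ by₀) ⁻¹ᵁ (by₀ ⁻¹ᵁ centreCompl Qy) : (pullback φ by₀).Opens) := by
      show by₀ (pullback.snd φ by₀ z) ∈ centreCompl Qy
      rw [hz, hccQy]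
      exact hy
    obtain ⟨z'', hz''⟩ := mem_range_imageι_of_mem _ hzO
    refine ⟨z'', ?_⟩
    show (blowupStrictTransformι φ by₀ Qy ≫ pullback.snd φ by₀) z'' = y
    rw [Scheme.Hom.comp_apply]
    erw [hz'']
    exact hz
  /- Step 5 (080M): extend the centre `𝓠y` from `Y₀` to a `V₁`-admissible centre `G` on `Y₁`,
    blow up and normalise: `b₂ : Y₂ → Y₁`, total `b = b₂ ≫ b₀₁`, centre `𝓠₂` with `V(𝓠₂) = Y ∖ V` -/
  obtain ⟨G, hGfg, hGcomap, hGV⟩ := exists_fg_comap_ι_eq_of_disjoint V₁ hV₁c Y₀ hY₀c Qy hQyfg (by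
    rw [hQysupp]; exact disjoint_compl_right)
  obtain ⟨Y₂, b₂, hb₂⟩ := exists_isBlowup Y₁ G
  obtain ⟨hb₂', hG'fg, hG'supp, Q₂, hQ₂fg, hQ₂supp, hbQ₂⟩ :=
    hbQ₁.normalised_comp hQ₁fg hQ₁supp hb₂ hGfg hGV
  haveI : IsProper b₂ := IsBlowup.isProper_of_fg hGfg hb₂
  set G' := G * Q₁.comap b₀₁ with hG'
  have hEG' : IsEffectiveCartier (G'.comap b₂) := hb₂'.isEffectiveCartier
  set b : Y₂ ⟶ Y := b₂ ≫ b₀₁ with hb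
  have hEQ₂ : IsEffectiveCartier (Q₂.comap b) := hbQ₂.isEffectiveCartier
  refine ⟨Q₂, Y₂, b, b₂ ⁻¹ᵁ Y₀, hQ₂fg, hQ₂supp, hbQ₂, ?_, ?_⟩
  · /- the closure of `b⁻¹(T)` lies in `b₂⁻¹(A) ⊆ b₂⁻¹(Y₀)` -/
    have h1 : b ⁻¹' T ⊆ b₂ ⁻¹' A := by
      intro x hx
      have hx' : b₁ (b₂ x) ∈ T₁ := hTvT₁ (show bv (b₁ (b₂ x)) ∈ T by
        rw [← Scheme.Hom.comp_apply, ← Scheme.Hom.comp_apply]; exact hx)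
      exact subset_closure hx'
    exact (closure_minimal h1 (isClosed_closure.preimage b₂.continuous)).trans
      (Set.preimage_mono hAY₀)
  · /- `f'` is an isomorphism over `b₂⁻¹(Y₀)`: transport `IsIso ψ₀` along the identifications -/
    -- (a) `by₂ : Y₂ ×_{Y₁} Y₀ → Y₀` is, like `by₀`, a blowing up of `Y₀` in `𝓠y · L`
    set by₂ := pullback.snd b₂ Y₀.ι with hby₂
    set j := pullback.fst b₂ Y₀.ι with hj
    set L := (Q₁.comap b₀₁).comap Y₀.ι with hL
    have hLc : IsEffectiveCartier L := hEQ₁.comap_of_isOpenImmersion Y₀.ι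
    have hG'Y₀ : G'.comap Y₀.ι = Qy * L := by rw [hG', comap_mul, hGcomap]
    have hby₂' : IsBlowup by₂ (Qy * L) := by
      rw [← hG'Y₀, hby₂, ← pullbackRestrictIsoRestrict_hom_morphismRestrict]
      exact (hb₂'.restrict Y₀).iso_comp (pullbackRestrictIsoRestrict b₂ Y₀)
    have hby₀' : IsBlowup by₀ (Qy * L) := hby₀.mul_of_isEffectiveCartier hLc
    obtain ⟨e, he, -⟩ := hby₀'.unique hby₂'
    have hEy₂ : IsEffectiveCartier (Qy.comap by₂) := by
      have h := hby₂'.isEffectiveCartier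
      rw [comap_mul] at h
      exact h.of_mul_left
    haveI : QuasiCompact ((pullback.snd φ by₂) ⁻¹ᵁ (by₂ ⁻¹ᵁ centreCompl Qy)).ι := by
      rw [preimage_centreCompl]
      exact quasiCompact_ι_preimage_centreCompl _ hEy₂
    have step_a : IsIso (blowupStrictTransformMap φ by₂ Qy) :=
      (MorphismProperty.isomorphisms.iff _).mp
        ((blowupStrictTransformMap_iff_of_iso_base φ Qy (MorphismProperty.isomorphisms Scheme.{u})
          by₀ by₂ e he).mpr ((MorphismProperty.isomorphisms.iff _).mpr inferInstance))
    -- (b) target locality: the strict transform of `f₁` along `j ≫ b₂` is an isomorphism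
    have hLsupp : (L.support : Set (Y₀ : Scheme.{u})) = (O₀ : Set (Y₀ : Scheme.{u}))ᶜ := by
      rw [hL, Scheme.IdealSheafData.support_comap, Scheme.IdealSheafData.support_comap]
      ext x
      change b₀₁ (Y₀.ι x) ∈ (Q₁.support : Set Y) ↔ ¬ (Y₀.ι x ∈ (V₁ : Set Y₁))
      rw [hQ₁supp, Set.mem_compl_iff]
      rfl
    have hcc : centreCompl Qy = centreCompl (G'.comap Y₀.ι) := by
      rw [hG'Y₀, hccQy]
      refine (centreCompl_eq_of_support_eq ?_).symm
      rw [Scheme.IdealSheafData.support_mul, TopologicalSpace.Closeds.coe_sup, hQysupp, hLsupp,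
        Set.union_self]
    have step_b : IsIso (blowupStrictTransformMap f₁ (j ≫ b₂) G') := by
      have h1 := (blowupStrictTransformMap_congr_centre φ by₂ (MorphismProperty.isomorphisms Scheme.{u})
        hcc).mp ((MorphismProperty.isomorphisms.iff _).mpr step_a)
      exact (MorphismProperty.isomorphisms.iff _).mp
        ((blowupStrictTransformMap_baseChange_iff f₁ b₂ G' Y₀.ι (MorphismProperty.isomorphisms Scheme.{u})
          hEG').mp h1)
    -- (c) the tower: the strict transform of `f` along `(j ≫ b₂) ≫ b₀₁` is an isomorphism
    have hEJ : IsEffectiveCartier (G'.comap (j ≫ b₂)) := by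
      rw [Scheme.IdealSheafData.comap_comp]
      exact hEG'.comap_of_isOpenImmersion j
    have hE₂ : IsEffectiveCartier (Q₂.comap ((j ≫ b₂) ≫ b₀₁)) := by
      rw [Category.assoc, Scheme.IdealSheafData.comap_comp]
      exact hEQ₂.comap_of_isOpenImmersion j
    have step_c : IsIso (blowupStrictTransformMap f ((j ≫ b₂) ≫ b₀₁) Q₂) :=
      (MorphismProperty.isomorphisms.iff _).mp
        ((blowupStrictTransformMap_tower_iff f V (MorphismProperty.isomorphisms Scheme.{u}) hQ₁supp hEQ₁
          (j ≫ b₂) G' hG'supp hEJ Q₂ hQ₂supp hE₂).mp ((MorphismProperty.isomorphisms.iff _).mpr step_b))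
    -- (d) reassociate and restrict over `j(Y₂ ×_{Y₁} Y₀) = b₂⁻¹(Y₀)`
    have hEjb : IsEffectiveCartier (Q₂.comap (j ≫ b)) := by
      rw [Scheme.IdealSheafData.comap_comp]
      exact hEQ₂.comap_of_isOpenImmersion j
    haveI : QuasiCompact ((pullback.snd f (j ≫ b)) ⁻¹ᵁ ((j ≫ b) ⁻¹ᵁ centreCompl Q₂)).ι := by
      rw [preimage_centreCompl]
      exact quasiCompact_ι_preimage_centreCompl _ hEjb
    have step_d : IsIso (blowupStrictTransformMap f (j ≫ b) Q₂) :=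
      (MorphismProperty.isomorphisms.iff _).mp
        ((blowupStrictTransformMap_iff_of_iso_base f Q₂ (MorphismProperty.isomorphisms Scheme.{u})
          ((j ≫ b₂) ≫ b₀₁) (j ≫ b) (Iso.refl _) (by rw [Iso.refl_hom, Category.id_comp, hb, Category.assoc])).mpr
          ((MorphismProperty.isomorphisms.iff _).mpr step_c))
    have step_e : IsIso (blowupStrictTransformMap f b Q₂ ∣_ j.opensRange) :=
      (isIso_morphismRestrict_opensRange_iff f b Q₂ j hEQ₂).mpr step_d
    have hN' : j.opensRange = b₂ ⁻¹ᵁ Y₀ := by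
      ext1
      rw [Scheme.Hom.coe_opensRange, hj, Scheme.Pullback.range_fst, Scheme.Opens.range_ι]
      rfl
    exact (MorphismProperty.isomorphisms.iff _).mp
      (((MorphismProperty.isomorphisms Scheme.{u}).arrow_mk_iso_iff
        (morphismRestrictEq (blowupStrictTransformMap f b Q₂) hN')).mp
        ((MorphismProperty.isomorphisms.iff _).mpr step_e))

end Main

end Literature.AlgebraicGeometry.Resolution

end
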